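import Literature.NumberTheory.GaloisRepresentations.ContinuousH1
import Literature.NumberTheory.GaloisRepresentations.ContinuousRep
import Literature.GroupTheory.Solvable.MinimalNormalSubgroup
import Literature.GroupTheory.Solvable.GaschutzLifting
import Mathlib.GroupTheory.GroupAction.ConjAct
import Mathlib.RepresentationTheory.Basic
import HarnessLib

/-!
# Generators of the finite quotients of a profinite group from a uniform bound on `H¹`
# (Gaschütz lifting along a chief series)

Topic `NumberTheory/GaloisRepresentations`; namespace
`Literature.NumberTheory.GaloisRepresentations`.  THEOREMS ONLY (no definition, no named fact).

Let `Γ` be a topological group.  Suppose that every continuous finite quotient of `Γ` is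
SOLVABLE, and that for some constant `C` every finite discrete `Γ`-module `M` killed by a prime
satisfies `#H¹_cont(Γ, M) ≤ |M| ^ C`.  Then **every continuous finite quotient of `Γ` is
generated by `C + 2` elements** (`exists_fin_generators_of_natCard_hOne_le`).  The proof is
W. Gaschütz' lifting argument (*Zu einem von B. H. und H. Neumann gestellten Problem*, Math.
Nachr. 14 (1955); tree `Literature.GroupTheory.Solvable.exists_closure_eq_top_of_natCard_crossedHom_lt`)
run along a chief series: for a continuous finite quotient `π : Γ ↠ G` and an abelian minimal
normal subgroup `N ⊴ G` (an `𝔽_ℓ`-vector space, Rotman Thm. 5.24, tree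
`Literature.GroupTheory.Solvable.elementary_abelian_of_minimal_normal`), the crossed
homomorphisms `G → N` number at most `|N| · #H¹_cont(Γ, N)` (`natCard_crossedHom_le_mul`: two
crossed homomorphisms with the same inflated class differ by a principal one), hence fewer than
`|N| ^ (C + 2)`; so `C + 2` generators of `G/N` lift to `C + 2` generators of `G`, and one inducts
on `|G|`.

For `Γ = Γ_F` the absolute Galois group of a `p`-adic field both hypotheses hold (finite quotients
are Galois groups of finite Galois extensions, solvable; the `H¹` bound is Tate's local
Euler–Poincaré characteristic, tree `natCard_continuousCohomology_one_le_pow`), which yields the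
topological finite generation of `Γ_F`
(`Literature/AnabelianGeometry/AbsoluteAnabelian/MLFGaloisTFGProofs.lean`).

## References

* W. Gaschütz, *Zu einem von B. H. und H. Neumann gestellten Problem*, Math. Nachr. 14 (1955),
  249–252. [Gaschutz1955]
* J. J. Rotman, *An Introduction to the Theory of Groups*, 4th ed., GTM 148 (1995), Thm. 5.24,
  Lemma 7.20. [Rotman1995]
-/

noncomputable section

open Function

namespace Literature.NumberTheory.GaloisRepresentations

open _root_.TopRep _root_.ContinuousCohomology
open scoped IsMulCommutative

/-! ### Crossed homomorphisms of a finite quotient versus continuous `H¹` -/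

section CrossedHom

variable {Γ : Type} [Group Γ] [TopologicalSpace Γ] [IsTopologicalGroup Γ]
variable {G : Type} [Group G] [TopologicalSpace G] [DiscreteTopology G] [Finite G]
variable {M : Type} [AddCommGroup M] [TopologicalSpace M] [DiscreteTopology M]

/-- **Crossed homomorphisms of a finite quotient are bounded by `|N| · #H¹`.**  Let `π : Γ ↠ G` be
a continuous surjection onto a finite discrete group, `N ⊴ G`, and let `ρ` be a discrete
`Γ`-module identified (`e`) with `N` carrying the conjugation action through `π`.  Inflating a
crossed homomorphism `c : G → N` (`c(ab) = c(a) · a c(b) a⁻¹`) along `π` gives a continuous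
`1`-cocycle of `Γ`; two crossed homomorphisms with the same class in `H¹_cont(Γ, ρ)` differ by a
principal crossed homomorphism `a ↦ a n a⁻¹ · n⁻¹`, of which there are at most `|N|`.  Hence
`#{crossed homomorphisms G → N} ≤ |N| · #H¹_cont(Γ, ρ)`.
[cite: Rotman1995, Lemma 7.72] [cite: Gaschutz1955, Satz 1 (proof), p. 250] -/
theorem natCard_crossedHom_le_mul (π : Γ →ₜ* G) (hπ : Surjective π) (N : Subgroup G) [N.Normal]
    (ρ : ContinuousRep Γ ℤ M) (e : Additive N ≃+ M)
    (he : ∀ (γ : Γ) (n : N), ρ γ (e (Additive.ofMul n)) =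
      e (Additive.ofMul ⟨π γ * n * (π γ)⁻¹, ‹N.Normal›.conj_mem _ n.2 _⟩))
    [Finite (continuousCohomology 1 ρ.toTopRep)] :
    Nat.card {c : G → N // ∀ a b : G, (c (a * b) : G) = c a * (a * c b * a⁻¹)} ≤
      Nat.card N * Nat.card (continuousCohomology 1 ρ.toTopRep) := by
  classical
  -- the continuous cocycle `γ ↦ e (c (π γ))` attached to a crossed homomorphism `c`
  have hcont : ∀ c : G → N, Continuous fun γ : Γ => e (Additive.ofMul (c (π γ))) := fun c =>
    (continuous_of_discreteTopology (f := fun a : G => e (Additive.ofMul (c a)))).comp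
      (map_continuous π)
  have hmem : ∀ c : {c : G → N // ∀ a b : G, (c (a * b) : G) = c a * (a * c b * a⁻¹)},
      (⟨fun γ : Γ => e (Additive.ofMul (c.1 (π γ))), hcont c.1⟩ : C(Γ, M)) ∈
        contOneCocycles ρ.toTopRep := by
    intro c
    rw [mem_contOneCocycles_iff]
    intro γ γ'
    have hc : c.1 (π γ * π γ') =
        c.1 (π γ) * ⟨π γ * c.1 (π γ') * (π γ)⁻¹, ‹N.Normal›.conj_mem _ (c.1 (π γ')).2 _⟩ :=
      Subtype.ext (c.2 (π γ) (π γ'))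
    change e (Additive.ofMul (c.1 (π (γ * γ')))) =
      e (Additive.ofMul (c.1 (π γ))) + ρ.toContRepresentation γ (e (Additive.ofMul (c.1 (π γ'))))
    rw [map_mul, hc, ofMul_mul, map_add, ContinuousRep.toContRepresentation_apply_apply, he]
  set κ : {c : G → N // ∀ a b : G, (c (a * b) : G) = c a * (a * c b * a⁻¹)} →
      continuousCohomology 1 ρ.toTopRep :=
    fun c => oneCocycleClass ρ.toTopRep ⟨_, hmem c⟩ with hκ
  -- two crossed homomorphisms with the same class differ by a principal crossed homomorphism
  have key : ∀ c₀ c : {c : G → N // ∀ a b : G, (c (a * b) : G) = c a * (a * c b * a⁻¹)},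
      κ c = κ c₀ → ∃ n : N, c.1 = fun a =>
        ⟨a * n * a⁻¹, ‹N.Normal›.conj_mem _ n.2 _⟩ * n⁻¹ * c₀.1 a := by
    intro c₀ c hcc
    have h0 : oneCocycleClass ρ.toTopRep (⟨_, hmem c⟩ - ⟨_, hmem c₀⟩) = 0 := by
      rw [oneCocycleClass_sub, sub_eq_zero]
      exact hcc
    obtain ⟨v, hv⟩ := (oneCocycleClass_eq_zero_iff ρ.toTopRep _).mp h0
    refine ⟨Additive.toMul (e.symm v), funext fun a => ?_⟩
    obtain ⟨γ, rfl⟩ := hπ a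
    have hvγ := hv γ
    change e (Additive.ofMul (c.1 (π γ))) - e (Additive.ofMul (c₀.1 (π γ))) =
      ρ.toContRepresentation γ v - v at hvγ
    rw [ContinuousRep.toContRepresentation_apply_apply] at hvγ
    have hv' : v = e (Additive.ofMul (Additive.toMul (e.symm v))) := by simp
    rw [hv', he, ← map_sub e, ← map_sub e] at hvγ
    have h1 := e.injective hvγ
    rw [← ofMul_div, ← ofMul_div, Additive.ofMul.injective.eq_iff, div_eq_iff_eq_mul,
      div_eq_mul_inv] at h1
    rw [h1, mul_assoc]
  -- a representative of each class in the range of `κ`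
  by_cases hne : Nonempty {c : G → N // ∀ a b : G, (c (a * b) : G) = c a * (a * c b * a⁻¹)}
  swap
  · rw [not_nonempty_iff] at hne
    rw [Nat.card_of_isEmpty]
    exact Nat.zero_le _
  obtain ⟨cdef⟩ := hne
  let rep : continuousCohomology 1 ρ.toTopRep →
      {c : G → N // ∀ a b : G, (c (a * b) : G) = c a * (a * c b * a⁻¹)} :=
    fun x => if h : ∃ c₀, κ c₀ = x then h.choose else cdef
  have hrep : ∀ c, κ (rep (κ c)) = κ c := fun c => by
    have h : ∃ c₀, κ c₀ = κ c := ⟨c, rfl⟩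
    simp only [rep, dif_pos h]
    exact h.choose_spec
  have hn : ∀ c, ∃ n : N, c.1 = fun a =>
      ⟨a * n * a⁻¹, ‹N.Normal›.conj_mem _ n.2 _⟩ * n⁻¹ * (rep (κ c)).1 a :=
    fun c => key (rep (κ c)) c (hrep c).symm
  choose nc hnc using hn
  -- `c ↦ (κ c, n_c)` is injective
  haveI : Finite {c : G → N // ∀ a b : G, (c (a * b) : G) = c a * (a * c b * a⁻¹)} :=
    Subtype.finite
  have hinj : Injective fun c => (κ c, nc c) := by
    intro c c' h
    simp only [Prod.mk.injEq] at h
    obtain ⟨h1, h2⟩ := h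
    apply Subtype.ext
    rw [hnc c, hnc c', h1, h2]
  calc Nat.card {c : G → N // ∀ a b : G, (c (a * b) : G) = c a * (a * c b * a⁻¹)}
      ≤ Nat.card (continuousCohomology 1 ρ.toTopRep × N) := Nat.card_le_card_of_injective _ hinj
    _ = Nat.card N * Nat.card (continuousCohomology 1 ρ.toTopRep) := by
        rw [Nat.card_prod, mul_comm]

end CrossedHom

/-! ### Gaschütz lifting along a chief series -/

section Gaschutz

variable {Γ : Type} [Group Γ] [TopologicalSpace Γ] [IsTopologicalGroup Γ]

/-- **One Gaschütz step for a continuous finite quotient.**  Let `Γ` be a topological group whose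
finite discrete `ℓ`-torsion modules `M` (`ℓ` prime) all satisfy `#H¹_cont(Γ, M) ≤ |M| ^ C`.  Let
`π : Γ ↠ G` be a continuous finite solvable quotient, `N ⊴ G` minimal normal, and `g : ι → G`
(`|ι| ≥ C + 2`) a family generating `G` modulo `N`.  Then some lift `g i · t i` (`t i ∈ N`)
generates `G`: `N` is an elementary abelian `ℓ`-group (Rotman 5.24); with the conjugation action
through `π` it is a discrete `Γ`-module killed by `ℓ`, so the crossed homomorphisms `G → N` number
at most `|N| · |N| ^ C < |N| ^ |ι|` (`natCard_crossedHom_le_mul`), and Gaschütz lifting applies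
(tree `exists_closure_eq_top_of_natCard_crossedHom_lt`).
[cite: Gaschutz1955, Satz 1] [cite: Rotman1995, Thm. 5.24] -/
theorem exists_lift_closure_eq_top_of_natCard_hOne_le {C : ℕ}
    (hB : ∀ (M : Type) [AddCommGroup M] [TopologicalSpace M] [DiscreteTopology M] [Finite M]
      (ρ : ContinuousRep Γ ℤ M) (ℓ : ℕ), ℓ.Prime → (∀ m : M, ℓ • m = 0) →
      Finite (continuousCohomology 1 ρ.toTopRep) ∧
        Nat.card (continuousCohomology 1 ρ.toTopRep) ≤ Nat.card M ^ C)
    {G : Type} [Group G] [TopologicalSpace G] [DiscreteTopology G] [Finite G] [IsSolvable G]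
    (π : Γ →ₜ* G) (hπ : Surjective π) (N : Subgroup G) [N.Normal] (hN : N ≠ ⊥)
    (hmin : ∀ K : Subgroup G, K.Normal → K ≤ N → K = ⊥ ∨ K = N)
    {ι : Type} [Finite ι] (hι : C + 2 ≤ Nat.card ι) (g : ι → G)
    (hg : Subgroup.closure (Set.range g) ⊔ N = ⊤) :
    ∃ t : ι → N, Subgroup.closure (Set.range fun i => g i * t i) = ⊤ := by
  classical
  obtain ⟨hcomm, ℓ, hℓ, hexp⟩ := Literature.GroupTheory.Solvable.elementary_abelian_of_minimal_normal hN hmin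
  haveI := hcomm
  -- the conjugation action of `Γ` on `N` through `π`, as a discrete `ℤ[Γ]`-module `Additive N`
  letI : MulDistribMulAction Γ N :=
    MulDistribMulAction.compHom N ((ConjAct.toConjAct (G := G)).toMonoidHom.comp (π : Γ →* G))
  let ρ : ContinuousRep Γ ℤ (Additive N) :=
    { toRepresentation := Representation.ofMulDistribMulAction Γ N
      continuous_smul :=
        (continuous_of_discreteTopology
          (f := fun q : G × Additive N => Additive.ofMul (ConjAct.toConjAct q.1 • q.2.toMul))).comp
          ((map_continuous π).prodMap continuous_id) }
  have hρ : ∀ (γ : Γ) (n : N), ρ γ (Additive.ofMul n) =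
      Additive.ofMul ⟨π γ * n * (π γ)⁻¹, ‹N.Normal›.conj_mem _ n.2 _⟩ := fun γ n => rfl
  have hM : ∀ m : Additive N, ℓ • m = 0 := fun m => by
    rw [← ofMul_toMul m, ← ofMul_pow, Subtype.ext_iff.mpr (by exact hexp _ (m.toMul).2 :
      ((Additive.toMul m ^ ℓ : N) : G) = ((1 : N) : G)), ofMul_one]
  obtain ⟨hfin, hcard⟩ := hB (Additive N) ρ ℓ hℓ hM
  haveI := hfin
  have hcross := natCard_crossedHom_le_mul π hπ N ρ (AddEquiv.refl _) (fun γ n => hρ γ n)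
  -- `#crossed homs ≤ |N| · |N|^C < |N|^(C+2) ≤ |N|^|ι|`
  have hNcard : 1 < Nat.card N := (Subgroup.one_lt_card_iff_ne_bot N).mpr hN
  have hAdd : Nat.card (Additive N) = Nat.card N := Nat.card_congr Additive.toMul
  refine Literature.GroupTheory.Solvable.exists_closure_eq_top_of_natCard_crossedHom_lt hmin g hg ?_
  calc Nat.card {c : G → N // ∀ a b : G, (c (a * b) : G) = c a * (a * c b * a⁻¹)}
      ≤ Nat.card N * Nat.card N ^ C := by
        refine hcross.trans (Nat.mul_le_mul_left _ ?_)
        rw [hAdd] at hcard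
        exact hcard
    _ = Nat.card N ^ (C + 1) := by ring
    _ < Nat.card N ^ (C + 2) := Nat.pow_lt_pow_right hNcard (by omega)
    _ ≤ Nat.card N ^ Nat.card ι := Nat.pow_le_pow_right (by omega) hι

/-- **Finite quotients are `(C + 2)`-generated.**  Let `Γ` be a topological group all of whose
continuous finite (discrete) quotients are solvable and whose finite discrete `ℓ`-torsion modules
(`ℓ` prime) satisfy `#H¹_cont(Γ, M) ≤ |M| ^ C`.  Then every continuous finite quotient `G` of `Γ`
is generated by `C + 2` elements — induction on `|G|` through a minimal normal subgroup (tree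
`Literature.GroupTheory.Solvable.exists_minimal_normal`) and the Gaschütz step
`exists_lift_closure_eq_top_of_natCard_hOne_le`. [cite: Gaschutz1955, Satz 1] -/
theorem exists_fin_generators_of_natCard_hOne_le {C : ℕ}
    (hB : ∀ (M : Type) [AddCommGroup M] [TopologicalSpace M] [DiscreteTopology M] [Finite M]
      (ρ : ContinuousRep Γ ℤ M) (ℓ : ℕ), ℓ.Prime → (∀ m : M, ℓ • m = 0) →
      Finite (continuousCohomology 1 ρ.toTopRep) ∧
        Nat.card (continuousCohomology 1 ρ.toTopRep) ≤ Nat.card M ^ C)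
    (hsolv : ∀ (G : Type) [Group G] [TopologicalSpace G] [DiscreteTopology G] [Finite G]
      (π : Γ →ₜ* G), Surjective π → IsSolvable G)
    (G : Type) [Group G] [TopologicalSpace G] [DiscreteTopology G] [Finite G]
    (π : Γ →ₜ* G) (hπ : Surjective π) :
    ∃ x : Fin (C + 2) → G, Subgroup.closure (Set.range x) = ⊤ := by
  classical
  -- strong induction on `|G|`
  suffices h : ∀ (n : ℕ) (G : Type) [Group G] [TopologicalSpace G] [DiscreteTopology G] [Finite G]
      (π : Γ →ₜ* G), Surjective π → Nat.card G = n →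
      ∃ x : Fin (C + 2) → G, Subgroup.closure (Set.range x) = ⊤ from h _ G π hπ rfl
  intro n
  induction n using Nat.strong_induction_on with
  | _ n ih =>
    intro G _ _ _ _ π hπ hn
    by_cases htriv : Subsingleton G
    · refine ⟨fun _ => 1, eq_top_iff.mpr fun x _ => ?_⟩
      rw [Subsingleton.elim x 1]
      exact Subgroup.one_mem _
    haveI : Nontrivial G := not_subsingleton_iff_nontrivial.mp htriv
    haveI : IsSolvable G := hsolv G π hπ
    obtain ⟨N, hNn, hNbot, hmin⟩ := Literature.GroupTheory.Solvable.exists_minimal_normal (G := G)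
    haveI := hNn
    -- the quotient `G ⧸ N`, a smaller continuous finite quotient of `Γ`
    letI : TopologicalSpace (G ⧸ N) := ⊥
    haveI : DiscreteTopology (G ⧸ N) := ⟨rfl⟩
    let π' : Γ →ₜ* G ⧸ N :=
      ⟨(QuotientGroup.mk' N).comp (π : Γ →* G),
        (continuous_of_discreteTopology (f := (QuotientGroup.mk' N : G → G ⧸ N))).comp
          (map_continuous π)⟩
    have hπ' : Surjective π' := (QuotientGroup.mk'_surjective N).comp hπ
    have hlt : Nat.card (G ⧸ N) < n := by
      have h1 : Nat.card G = Nat.card (G ⧸ N) * Nat.card N :=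
        Subgroup.card_eq_card_quotient_mul_card_subgroup N
      have h2 : 1 < Nat.card N := (Subgroup.one_lt_card_iff_ne_bot N).mpr hNbot
      have h3 : 0 < Nat.card (G ⧸ N) := Nat.card_pos
      rw [← hn, h1]
      nlinarith
    obtain ⟨y, hy⟩ := ih _ hlt (G ⧸ N) π' hπ' rfl
    -- lift the generators and apply the Gaschütz step
    choose g hg using fun i => QuotientGroup.mk_surjective (y i)
    have hgN : Subgroup.closure (Set.range g) ⊔ N = ⊤ := by
      have hmap : Subgroup.map (QuotientGroup.mk' N) (Subgroup.closure (Set.range g)) = ⊤ := by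
        rw [MonoidHom.map_closure, ← Set.range_comp]
        have : (QuotientGroup.mk' N) ∘ g = y := funext fun i => hg i
        rw [this, hy]
      have := Subgroup.comap_map_eq (QuotientGroup.mk' N) (Subgroup.closure (Set.range g))
      rw [hmap, Subgroup.comap_top, QuotientGroup.ker_mk'] at this
      exact this.symm
    have hι : C + 2 ≤ Nat.card (Fin (C + 2)) := by simp
    obtain ⟨t, ht⟩ := exists_lift_closure_eq_top_of_natCard_hOne_le hB π hπ N hNbot hmin hι g hgN
    exact ⟨fun i => g i * t i, ht⟩

end Gaschutz

end Literature.NumberTheory.GaloisRepresentations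

end
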